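import Summits.Ventures.PercRepro.C025ProfilePLDSixLiftArith

/-!
# THE RANK-6 UNIFORM MATROID U_{6,m} FOR EVERY m ≥ 12 FROM THE CASE m = 12 AND THE EXACT RANK-9 PRESERVERS: THE ARITHMETIC (night-3 g34)

`proofs/NIGHT3-G34-FASTLIFT.md` §3.  At rank ≤ 9 the joint-LP search (kit j329966) keeps q₆ = T₁₆ + 3·T₂₆ + 6·T₃₆ + 9·T₄₆ + 11·T₅₆,
q₆′ = T₂₆ + 2·T₃₆ + 3·T₄₆ + 4·T₅₆, q₆″ = T₃₆ + 2·T₄₆ + 3·T₅₆ and moves the fourth preserver to q₆‴ = T₄₆ + 3·T₅₆ (optimum 2.043;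
T₄₆ + 2·T₅₆ is infeasible at rank 9).  With it the identity from the base `m₀ = 11` needs a negative amount of `T₅₆` at `m = 12`,
so the base is `m₀ = 12`:
`120·(U_{6,12+k} − U_{6,12}) = 120k·q₆ + k(1020 + 60k)·q₆′ + k(4480 + 540k + 20k²)·q₆″ + k(9790 + 2035k + 170k² + 5k³)·q₆‴ + k(294 + 1885k + 425k² + 35k³ + k⁴)·T₅₆ + 120(c_m − c₁₂)·δ₆₆`
(`lift_alg_six_nine`), reusing g33's thirteen-layer profile lemma `sum_choose_min_six` (valid for `m ≥ 11`) and `sum_choose_mid6_mono`.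
`T₅₆` and `δ₆₆` preserve PER-LAYER DOMINANCE (g29), the `q`'s do at rank ≤ 9 (certificate tables); hence the lift
`lift_instance_six_nine` for every `12 ≤ m`.  No `def`, no `instance`, no notation.  Axioms: standard.
-/

namespace PercRepro

open Finset

namespace PLDSixLift

variable {ι : Type}

/-- `120·C(12+k, 2) = 7920 + 1380 * k + 60 * k * k`. -/
theorem choose_two_twelve_nine (k : ℕ) : 120 * (12 + k).choose 2 = 7920 + 1380 * k + 60 * k * k := by
  have h := PLDSolidLift.two_mul_choose_two (12 + k)
  rw [show 12 + k - 1 = 11 + k by omega] at h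
  nlinarith [h]

/-- `120·C(12+k, 3) = 26400 + 7240 * k + 660 * k * k + 20 * k * k * k`. -/
theorem choose_three_twelve_nine (k : ℕ) : 120 * (12 + k).choose 3 = 26400 + 7240 * k + 660 * k * k + 20 * k * k * k := by
  have h := PLDSolidLift.six_mul_choose_three (12 + k)
  rw [show 12 + k - 1 = 11 + k by omega, show 12 + k - 2 = 10 + k by omega] at h
  nlinarith [h]

/-- `120·C(12+k, 4) = 59400 + 22890 * k + 3295 * k * k + 210 * k * k * k + 5 * k * k * k * k`. -/
theorem choose_four_twelve_nine (k : ℕ) : 120 * (12 + k).choose 4 = 59400 + 22890 * k + 3295 * k * k + 210 * k * k * k + 5 * k * k * k * k := by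
  have h := PLDFiveLift.twentyfour_mul_choose_four (12 + k)
  rw [show 12 + k - 1 = 11 + k by omega, show 12 + k - 2 = 10 + k by omega, show 12 + k - 3 = 9 + k by omega] at h
  nlinarith [h]

/-- `120·C(12+k, 5) = 95040 + 48504 * k + 9850 * k * k + 995 * k * k * k + 50 * k * k * k * k + k * k * k * k * k`. -/
theorem choose_five_twelve_nine (k : ℕ) : 120 * (12 + k).choose 5 = 95040 + 48504 * k + 9850 * k * k + 995 * k * k * k + 50 * k * k * k * k + k * k * k * k * k := by
  have h := PLDSixLift.onehundredtwenty_mul_choose_five (12 + k)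
  rw [show 12 + k - 1 = 11 + k by omega, show 12 + k - 2 = 10 + k by omega, show 12 + k - 3 = 9 + k by omega, show 12 + k - 4 = 8 + k by omega] at h
  nlinarith [h]

/-- The linear algebra of the rank-6 lift from `m₀ = 12`, with the layer sums and the coefficients abstracted. -/
theorem lift_alg_six_nine (a06 a16 a26 a36 a46 a56 a66 a65 a64 a63 a62 a61 a60
    b06 b16 b26 b36 b46 b56 b66 b65 b64 b63 b62 b61 b60 k k' C2 C3 C4 C5 c₀ : ℕ)
    (hC2 : 120 * C2 = 7920 + 1380 * k + 60 * k * k)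
    (hC3 : 120 * C3 = 26400 + 7240 * k + 660 * k * k + 20 * k * k * k)
    (hC4 : 120 * C4 = 59400 + 22890 * k + 3295 * k * k + 210 * k * k * k + 5 * k * k * k * k)
    (hC5 : 120 * C5 = 95040 + 48504 * k + 9850 * k * k + 995 * k * k * k + 50 * k * k * k * k + k * k * k * k * k)
    (h₀ : a06 + 12 * a16 + 66 * a26 + 220 * a36 + 495 * a46 + 792 * a56 + c₀ * a66 + 792 * a65 + 495 * a64 + 220 * a63 + 66 * a62 + 12 * a61 + a60 ≤
      b06 + 12 * b16 + 66 * b26 + 220 * b36 + 495 * b46 + 792 * b56 + c₀ * b66 + 792 * b65 + 495 * b64 + 220 * b63 + 66 * b62 + 12 * b61 + b60)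
    (hq : (a16 + a61) + 3 * (a26 + a62) + 6 * (a36 + a63) + 9 * (a46 + a64) + 11 * (a56 + a65) ≤ (b16 + b61) + 3 * (b26 + b62) + 6 * (b36 + b63) + 9 * (b46 + b64) + 11 * (b56 + b65))
    (hq' : (a26 + a62) + 2 * (a36 + a63) + 3 * (a46 + a64) + 4 * (a56 + a65) ≤ (b26 + b62) + 2 * (b36 + b63) + 3 * (b46 + b64) + 4 * (b56 + b65))
    (hq'' : (a36 + a63) + 2 * (a46 + a64) + 3 * (a56 + a65) ≤ (b36 + b63) + 2 * (b46 + b64) + 3 * (b56 + b65))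
    (hq''' : (a46 + a64) + 3 * (a56 + a65) ≤ (b46 + b64) + 3 * (b56 + b65))
    (hT : a56 + a65 ≤ b56 + b65) (hS : a66 ≤ b66) :
    a06 + (12 + k) * a16 + C2 * a26 + C3 * a36 + C4 * a46 + C5 * a56 + (c₀ + k') * a66 + C5 * a65 + C4 * a64 + C3 * a63 + C2 * a62 + (12 + k) * a61 + a60 ≤
      b06 + (12 + k) * b16 + C2 * b26 + C3 * b36 + C4 * b46 + C5 * b56 + (c₀ + k') * b66 + C5 * b65 + C4 * b64 + C3 * b63 + C2 * b62 + (12 + k) * b61 + b60 := by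
  have eC2a26 : 120 * C2 * a26 = (7920 + 1380 * k + 60 * k * k) * a26 := by rw [hC2]
  have eC2a62 : 120 * C2 * a62 = (7920 + 1380 * k + 60 * k * k) * a62 := by rw [hC2]
  have eC2b26 : 120 * C2 * b26 = (7920 + 1380 * k + 60 * k * k) * b26 := by rw [hC2]
  have eC2b62 : 120 * C2 * b62 = (7920 + 1380 * k + 60 * k * k) * b62 := by rw [hC2]
  have eC3a36 : 120 * C3 * a36 = (26400 + 7240 * k + 660 * k * k + 20 * k * k * k) * a36 := by rw [hC3]
  have eC3a63 : 120 * C3 * a63 = (26400 + 7240 * k + 660 * k * k + 20 * k * k * k) * a63 := by rw [hC3]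
  have eC3b36 : 120 * C3 * b36 = (26400 + 7240 * k + 660 * k * k + 20 * k * k * k) * b36 := by rw [hC3]
  have eC3b63 : 120 * C3 * b63 = (26400 + 7240 * k + 660 * k * k + 20 * k * k * k) * b63 := by rw [hC3]
  have eC4a46 : 120 * C4 * a46 = (59400 + 22890 * k + 3295 * k * k + 210 * k * k * k + 5 * k * k * k * k) * a46 := by rw [hC4]
  have eC4a64 : 120 * C4 * a64 = (59400 + 22890 * k + 3295 * k * k + 210 * k * k * k + 5 * k * k * k * k) * a64 := by rw [hC4]
  have eC4b46 : 120 * C4 * b46 = (59400 + 22890 * k + 3295 * k * k + 210 * k * k * k + 5 * k * k * k * k) * b46 := by rw [hC4]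
  have eC4b64 : 120 * C4 * b64 = (59400 + 22890 * k + 3295 * k * k + 210 * k * k * k + 5 * k * k * k * k) * b64 := by rw [hC4]
  have eC5a56 : 120 * C5 * a56 = (95040 + 48504 * k + 9850 * k * k + 995 * k * k * k + 50 * k * k * k * k + k * k * k * k * k) * a56 := by rw [hC5]
  have eC5a65 : 120 * C5 * a65 = (95040 + 48504 * k + 9850 * k * k + 995 * k * k * k + 50 * k * k * k * k + k * k * k * k * k) * a65 := by rw [hC5]
  have eC5b56 : 120 * C5 * b56 = (95040 + 48504 * k + 9850 * k * k + 995 * k * k * k + 50 * k * k * k * k + k * k * k * k * k) * b56 := by rw [hC5]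
  have eC5b65 : 120 * C5 * b65 = (95040 + 48504 * k + 9850 * k * k + 995 * k * k * k + 50 * k * k * k * k + k * k * k * k * k) * b65 := by rw [hC5]
  have hqk := Nat.mul_le_mul_left (k * (120)) hq
  have hq'k := Nat.mul_le_mul_left (k * (1020 + 60 * k)) hq'
  have hq''k := Nat.mul_le_mul_left (k * (4480 + 540 * k + 20 * k * k)) hq''
  have hq'''k := Nat.mul_le_mul_left (k * (9790 + 2035 * k + 170 * k * k + 5 * k * k * k)) hq'''
  have hTk := Nat.mul_le_mul_left (k * (294 + 1885 * k + 425 * k * k + 35 * k * k * k + k * k * k * k)) hT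
  have hSk := Nat.mul_le_mul_left (120 * k') hS
  linarith [eC2a26, eC2a62, eC2b26, eC2b62, eC3a36, eC3a63, eC3b36, eC3b63, eC4a46, eC4a64, eC4b46, eC4b64, eC5a56, eC5a65, eC5b56, eC5b65, hqk, hq'k, hq''k, hq'''k, hTk, hSk, h₀]

/-- THE LIFT IN `m` FOR `U_{6,m}` from `m₀ = 12`: for a family `(s, x, f)` with (PLD), `12 ≤ m`, an admissible `(lo, hi, δ, Θ)`,
the preserver instances and the `U_{6,12}`-instance give the `U_{6,m}`-instance. -/
theorem lift_instance_six_nine (s : Finset ι) (x f : ι → ℕ)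
    (hPLD : ∀ lo hi δ Θ : ℕ, Θ ≤ lo + hi + δ → (lo = 0 ∨ lo + hi + δ ≤ Θ) →
      ∑ i ∈ s, (if lo ≤ x i ∧ x i ≤ hi ∧ Θ ≤ f i + x i then (f i).choose δ else 0) ≤
        ∑ i ∈ s, (if lo + δ ≤ f i ∧ f i ≤ hi + δ then (f i).choose δ else 0))
    (m : ℕ) (hm : 12 ≤ m) (lo hi δ Θ : ℕ) (hΘ : Θ ≤ lo + hi + δ) (hlo : lo = 0 ∨ lo + hi + δ ≤ Θ)
    (hq : ∑ i ∈ s, (((if lo ≤ x i + 1 ∧ x i + 1 ≤ hi ∧ Θ ≤ (f i + 6) + (x i + 1) then (f i + 6).choose δ else 0) + (if lo ≤ x i + 6 ∧ x i + 6 ≤ hi ∧ Θ ≤ (f i + 1) + (x i + 6) then (f i + 1).choose δ else 0)) + 3 * ((if lo ≤ x i + 2 ∧ x i + 2 ≤ hi ∧ Θ ≤ (f i + 6) + (x i + 2) then (f i + 6).choose δ else 0) + (if lo ≤ x i + 6 ∧ x i + 6 ≤ hi ∧ Θ ≤ (f i + 2) + (x i + 6) then (f i + 2).choose δ else 0)) +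 6 * ((if lo ≤ x i + 3 ∧ x i + 3 ≤ hi ∧ Θ ≤ (f i + 6) + (x i + 3) then (f i + 6).choose δ else 0) + (if lo ≤ x i + 6 ∧ x i + 6 ≤ hi ∧ Θ ≤ (f i + 3) + (x i + 6) then (f i + 3).choose δ else 0)) + 9 * ((if lo ≤ x i + 4 ∧ x i + 4 ≤ hi ∧ Θ ≤ (f i + 6) + (x i + 4) then (f i + 6).choose δ else 0) + (if lo ≤ x i + 6 ∧ x i + 6 ≤ hi ∧ Θ ≤ (f i + 4) + (x i + 6) then (f i + 4).choose δ else 0)) + 11 * ((if lo ≤ x i + 5 ∧ x i + 5 ≤ hi ∧ Θ ≤ (f i + 6) + (x i + 5) then (f i + 6).choose δ else 0) + (if lo ≤ x i + 6 ∧ x i + 6 ≤ hi ∧ Θ ≤ (f i + 5) + (x i + 6) then (f i + 5).choose δ else 0))) ≤ ∑ i ∈ s, (((if lo + δ ≤ f i + 6 ∧ f i + 6 ≤ hi + δ then (f i + 6).choose δ else 0) + (if lo + δ ≤ f i + 1 ∧ f i + 1 ≤ hi + δ then (f i + 1).choose δ else 0)) + 3 * ((if lo + δ ≤ f i + 6 ∧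 f i + 6 ≤ hi + δ then (f i + 6).choose δ else 0) + (if lo + δ ≤ f i + 2 ∧ f i + 2 ≤ hi + δ then (f i + 2).choose δ else 0)) + 6 * ((if lo + δ ≤ f i + 6 ∧ f i + 6 ≤ hi + δ then (f i + 6).choose δ else 0) + (if lo + δ ≤ f i + 3 ∧ f i + 3 ≤ hi + δ then (f i + 3).choose δ else 0)) + 9 * ((if lo + δ ≤ f i + 6 ∧ f i + 6 ≤ hi + δ then (f i + 6).choose δ else 0) + (if lo + δ ≤ f i + 4 ∧ f i + 4 ≤ hi + δ then (f i + 4).choose δ else 0)) + 11 * ((if lo + δ ≤ f i + 6 ∧ f i + 6 ≤ hi + δ then (f i + 6).choose δ else 0) + (if lo + δ ≤ f i + 5 ∧ f i + 5 ≤ hi + δ then (f i + 5).choose δ else 0))))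
    (hq' : ∑ i ∈ s, (((if lo ≤ x i + 2 ∧ x i + 2 ≤ hi ∧ Θ ≤ (f i + 6) + (x i + 2) then (f i + 6).choose δ else 0) + (if lo ≤ x i + 6 ∧ x i + 6 ≤ hi ∧ Θ ≤ (f i + 2) + (x i + 6) then (f i + 2).choose δ else 0)) + 2 * ((if lo ≤ x i + 3 ∧ x i + 3 ≤ hi ∧ Θ ≤ (f i + 6) + (x i + 3) then (f i + 6).choose δ else 0) + (if lo ≤ x i + 6 ∧ x i + 6 ≤ hi ∧ Θ ≤ (f i + 3) + (x i + 6) then (f i + 3).choose δ else 0)) + 3 * ((if lo ≤ x i + 4 ∧ x i + 4 ≤ hi ∧ Θ ≤ (f i + 6) + (x i + 4) then (f i + 6).choose δ else 0) + (if lo ≤ x i + 6 ∧ x i + 6 ≤ hi ∧ Θ ≤ (f i + 4) + (x i + 6) then (f i + 4).choose δ else 0)) + 4 * ((if lo ≤ x i + 5 ∧ x i + 5 ≤ hi ∧ Θ ≤ (f i + 6) + (x i + 5) then (f i + 6).choose δ else 0) + (if lo ≤ x i + 6 ∧ x i + 6 ≤ hi ∧ Θ ≤ (f i + 5) + (x i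 + 6) then (f i + 5).choose δ else 0))) ≤ ∑ i ∈ s, (((if lo + δ ≤ f i + 6 ∧ f i + 6 ≤ hi + δ then (f i + 6).choose δ else 0) + (if lo + δ ≤ f i + 2 ∧ f i + 2 ≤ hi + δ then (f i + 2).choose δ else 0)) + 2 * ((if lo + δ ≤ f i + 6 ∧ f i + 6 ≤ hi + δ then (f i + 6).choose δ else 0) + (if lo + δ ≤ f i + 3 ∧ f i + 3 ≤ hi + δ then (f i + 3).choose δ else 0)) + 3 * ((if lo + δ ≤ f i + 6 ∧ f i + 6 ≤ hi + δ then (f i + 6).choose δ else 0) + (if lo + δ ≤ f i + 4 ∧ f i + 4 ≤ hi + δ then (f i + 4).choose δ else 0)) + 4 * ((if lo + δ ≤ f i + 6 ∧ f i + 6 ≤ hi + δ then (f i + 6).choose δ else 0) + (if lo + δ ≤ f i + 5 ∧ f i + 5 ≤ hi + δ then (f i + 5).choose δ else 0))))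
    (hq'' : ∑ i ∈ s, (((if lo ≤ x i + 3 ∧ x i + 3 ≤ hi ∧ Θ ≤ (f i + 6) + (x i + 3) then (f i + 6).choose δ else 0) + (if lo ≤ x i + 6 ∧ x i + 6 ≤ hi ∧ Θ ≤ (f i + 3) + (x i + 6) then (f i + 3).choose δ else 0)) + 2 * ((if lo ≤ x i + 4 ∧ x i + 4 ≤ hi ∧ Θ ≤ (f i + 6) + (x i + 4) then (f i + 6).choose δ else 0) + (if lo ≤ x i + 6 ∧ x i + 6 ≤ hi ∧ Θ ≤ (f i + 4) + (x i + 6) then (f i + 4).choose δ else 0)) + 3 * ((if lo ≤ x i + 5 ∧ x i + 5 ≤ hi ∧ Θ ≤ (f i + 6) + (x i + 5) then (f i + 6).choose δ else 0) + (if lo ≤ x i + 6 ∧ x i + 6 ≤ hi ∧ Θ ≤ (f i + 5) + (x i + 6) then (f i + 5).choose δ else 0))) ≤ ∑ i ∈ s, (((if lo + δ ≤ f i + 6 ∧ f i + 6 ≤ hi + δ then (f i + 6).choose δ else 0) + (if lo + δ ≤ f i + 3 ∧ f i + 3 ≤ hi + δ then (f i + 3).choose δ else 0)) + 2 * ((if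 lo + δ ≤ f i + 6 ∧ f i + 6 ≤ hi + δ then (f i + 6).choose δ else 0) + (if lo + δ ≤ f i + 4 ∧ f i + 4 ≤ hi + δ then (f i + 4).choose δ else 0)) + 3 * ((if lo + δ ≤ f i + 6 ∧ f i + 6 ≤ hi + δ then (f i + 6).choose δ else 0) + (if lo + δ ≤ f i + 5 ∧ f i + 5 ≤ hi + δ then (f i + 5).choose δ else 0))))
    (hq''' : ∑ i ∈ s, (((if lo ≤ x i + 4 ∧ x i + 4 ≤ hi ∧ Θ ≤ (f i + 6) + (x i + 4) then (f i + 6).choose δ else 0) + (if lo ≤ x i + 6 ∧ x i + 6 ≤ hi ∧ Θ ≤ (f i + 4) + (x i + 6) then (f i + 4).choose δ else 0)) + 3 * ((if lo ≤ x i + 5 ∧ x i + 5 ≤ hi ∧ Θ ≤ (f i + 6) + (x i + 5) then (f i + 6).choose δ else 0) + (if lo ≤ x i + 6 ∧ x i + 6 ≤ hi ∧ Θ ≤ (f i + 5) + (x i + 6) then (f i + 5).choose δ else 0))) ≤ ∑ i ∈ s, (((if lo + δ ≤ f i + 6 ∧ f i + 6 ≤ hi + δ then (f i + 6).choose δ else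 0) + (if lo + δ ≤ f i + 4 ∧ f i + 4 ≤ hi + δ then (f i + 4).choose δ else 0)) + 3 * ((if lo + δ ≤ f i + 6 ∧ f i + 6 ≤ hi + δ then (f i + 6).choose δ else 0) + (if lo + δ ≤ f i + 5 ∧ f i + 5 ≤ hi + δ then (f i + 5).choose δ else 0))))
    (h₀ : ∑ i ∈ s, ∑ j ∈ range (12 + 1), Nat.choose 12 j *
        (if lo ≤ x i + min j 6 ∧ x i + min j 6 ≤ hi ∧ Θ ≤ (f i + min (12 - j) 6) + (x i + min j 6) then
          (f i + min (12 - j) 6).choose δ else 0) ≤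
      ∑ i ∈ s, ∑ j ∈ range (12 + 1), Nat.choose 12 j *
        (if lo + δ ≤ f i + min (12 - j) 6 ∧ f i + min (12 - j) 6 ≤ hi + δ then (f i + min (12 - j) 6).choose δ else 0)) :
    ∑ i ∈ s, ∑ j ∈ range (m + 1), Nat.choose m j *
        (if lo ≤ x i + min j 6 ∧ x i + min j 6 ≤ hi ∧ Θ ≤ (f i + min (m - j) 6) + (x i + min j 6) then
          (f i + min (m - j) 6).choose δ else 0) ≤
      ∑ i ∈ s, ∑ j ∈ range (m + 1), Nat.choose m j *
        (if lo + δ ≤ f i + min (m - j) 6 ∧ f i + min (m - j) 6 ≤ hi + δ then (f i + min (m - j) 6).choose δ else 0) := by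
  -- the preservers `T_{5,6}` and `δ_{66}`
  have h11 : ∀ lo hi δ Θ : ℕ, Θ ≤ lo + hi + δ → (lo = 0 ∨ lo + hi + δ ≤ Θ) →
      ∑ i ∈ s, (if lo ≤ x i + 1 ∧ x i + 1 ≤ hi ∧ Θ ≤ (f i + 1) + (x i + 1) then (f i + 1).choose δ else 0) ≤
        ∑ i ∈ s, (if lo + δ ≤ f i + 1 ∧ f i + 1 ≤ hi + δ then (f i + 1).choose δ else 0) :=
    fun lo hi δ Θ h1 h2 => PLDClosure.shift11 s x f hPLD lo hi δ Θ h1 h2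
  have h22 : ∀ lo hi δ Θ : ℕ, Θ ≤ lo + hi + δ → (lo = 0 ∨ lo + hi + δ ≤ Θ) →
      ∑ i ∈ s, (if lo ≤ x i + 2 ∧ x i + 2 ≤ hi ∧ Θ ≤ (f i + 2) + (x i + 2) then (f i + 2).choose δ else 0) ≤
        ∑ i ∈ s, (if lo + δ ≤ f i + 2 ∧ f i + 2 ≤ hi + δ then (f i + 2).choose δ else 0) :=
    fun lo hi δ Θ h1 h2 => PLDClosure.shift11 s (fun i => x i + 1) (fun i => f i + 1) h11 lo hi δ Θ h1 h2
  have h33 : ∀ lo hi δ Θ : ℕ, Θ ≤ lo + hi + δ → (lo = 0 ∨ lo + hi + δ ≤ Θ) →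
      ∑ i ∈ s, (if lo ≤ x i + 3 ∧ x i + 3 ≤ hi ∧ Θ ≤ (f i + 3) + (x i + 3) then (f i + 3).choose δ else 0) ≤
        ∑ i ∈ s, (if lo + δ ≤ f i + 3 ∧ f i + 3 ≤ hi + δ then (f i + 3).choose δ else 0) :=
    fun lo hi δ Θ h1 h2 => PLDClosure.shift11 s (fun i => x i + 2) (fun i => f i + 2) h22 lo hi δ Θ h1 h2
  have h44 : ∀ lo hi δ Θ : ℕ, Θ ≤ lo + hi + δ → (lo = 0 ∨ lo + hi + δ ≤ Θ) →
      ∑ i ∈ s, (if lo ≤ x i + 4 ∧ x i + 4 ≤ hi ∧ Θ ≤ (f i + 4) + (x i + 4) then (f i + 4).choose δ else 0) ≤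
        ∑ i ∈ s, (if lo + δ ≤ f i + 4 ∧ f i + 4 ≤ hi + δ then (f i + 4).choose δ else 0) :=
    fun lo hi δ Θ h1 h2 => PLDClosure.shift11 s (fun i => x i + 3) (fun i => f i + 3) h33 lo hi δ Θ h1 h2
  have h55 : ∀ lo hi δ Θ : ℕ, Θ ≤ lo + hi + δ → (lo = 0 ∨ lo + hi + δ ≤ Θ) →
      ∑ i ∈ s, (if lo ≤ x i + 5 ∧ x i + 5 ≤ hi ∧ Θ ≤ (f i + 5) + (x i + 5) then (f i + 5).choose δ else 0) ≤
        ∑ i ∈ s, (if lo + δ ≤ f i + 5 ∧ f i + 5 ≤ hi + δ then (f i + 5).choose δ else 0) :=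
    fun lo hi δ Θ h1 h2 => PLDClosure.shift11 s (fun i => x i + 4) (fun i => f i + 4) h44 lo hi δ Θ h1 h2
  have hT : ∑ i ∈ s, ((if lo ≤ x i + 5 ∧ x i + 5 ≤ hi ∧ Θ ≤ (f i + 6) + (x i + 5) then (f i + 6).choose δ else 0) + (if lo ≤ x i + 6 ∧ x i + 6 ≤ hi ∧ Θ ≤ (f i + 5) + (x i + 6) then (f i + 5).choose δ else 0)) ≤ ∑ i ∈ s, ((if lo + δ ≤ f i + 6 ∧ f i + 6 ≤ hi + δ then (f i + 6).choose δ else 0) + (if lo + δ ≤ f i + 5 ∧ f i + 5 ≤ hi + δ then (f i + 5).choose δ else 0)) :=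
    PLDClosure.coloop s (fun i => x i + 5) (fun i => f i + 5) h55 lo hi δ Θ hΘ hlo
  have hS : ∑ i ∈ s, (if lo ≤ x i + 6 ∧ x i + 6 ≤ hi ∧ Θ ≤ (f i + 6) + (x i + 6) then (f i + 6).choose δ else 0) ≤ ∑ i ∈ s, (if lo + δ ≤ f i + 6 ∧ f i + 6 ≤ hi + δ then (f i + 6).choose δ else 0) :=
    PLDClosure.shift11 s (fun i => x i + 5) (fun i => f i + 5) h55 lo hi δ Θ hΘ hlo
  -- the layers, for `m` and for `12`
  have hLm : ∀ n : ℕ, 12 ≤ n → ∀ i ∈ s, ∑ j ∈ range (n + 1), Nat.choose n j *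
        (if lo ≤ x i + min j 6 ∧ x i + min j 6 ≤ hi ∧ Θ ≤ (f i + min (n - j) 6) + (x i + min j 6) then
          (f i + min (n - j) 6).choose δ else 0) =
      (if lo ≤ x i ∧ x i ≤ hi ∧ Θ ≤ (f i + 6) + (x i) then (f i + 6).choose δ else 0) + n * (if lo ≤ x i + 1 ∧ x i + 1 ≤ hi ∧ Θ ≤ (f i + 6) + (x i + 1) then (f i + 6).choose δ else 0) + n.choose 2 * (if lo ≤ x i + 2 ∧ x i + 2 ≤ hi ∧ Θ ≤ (f i + 6) + (x i + 2) then (f i + 6).choose δ else 0) + n.choose 3 * (if lo ≤ x i + 3 ∧ x i + 3 ≤ hi ∧ Θ ≤ (f i + 6) + (x i + 3) then (f i + 6).choose δ else 0) + n.choose 4 * (if lo ≤ x i + 4 ∧ x i + 4 ≤ hi ∧ Θ ≤ (f i + 6) + (x i + 4) then (f i + 6).choose δ else 0) + n.choose 5 * (if lo ≤ x i + 5 ∧ x i + 5 ≤ hi ∧ Θ ≤ (f i + 6) + (x i + 5) then (f i + 6).choose δ else 0) + (∑ i ∈ Ico 6 (n - 5), n.choose i) * (if lo ≤ x i + 6 ∧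 x i + 6 ≤ hi ∧ Θ ≤ (f i + 6) + (x i + 6) then (f i + 6).choose δ else 0) + n.choose 5 * (if lo ≤ x i + 6 ∧ x i + 6 ≤ hi ∧ Θ ≤ (f i + 5) + (x i + 6) then (f i + 5).choose δ else 0) + n.choose 4 * (if lo ≤ x i + 6 ∧ x i + 6 ≤ hi ∧ Θ ≤ (f i + 4) + (x i + 6) then (f i + 4).choose δ else 0) + n.choose 3 * (if lo ≤ x i + 6 ∧ x i + 6 ≤ hi ∧ Θ ≤ (f i + 3) + (x i + 6) then (f i + 3).choose δ else 0) + n.choose 2 * (if lo ≤ x i + 6 ∧ x i + 6 ≤ hi ∧ Θ ≤ (f i + 2) + (x i + 6) then (f i + 2).choose δ else 0) + n * (if lo ≤ x i + 6 ∧ x i + 6 ≤ hi ∧ Θ ≤ (f i + 1) + (x i + 6) then (f i + 1).choose δ else 0) + (if lo ≤ x i + 6 ∧ x i + 6 ≤ hi ∧ Θ ≤ (f i) + (x i + 6) then (f i).choose δ else 0) :=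
    fun n hn i _ => PLDSixLift.sum_choose_min_six n (by omega)
      (fun a b => if lo ≤ x i + a ∧ x i + a ≤ hi ∧ Θ ≤ (f i + b) + (x i + a) then (f i + b).choose δ else 0)
  have hRm : ∀ n : ℕ, 12 ≤ n → ∀ i ∈ s, ∑ j ∈ range (n + 1), Nat.choose n j *
        (if lo + δ ≤ f i + min (n - j) 6 ∧ f i + min (n - j) 6 ≤ hi + δ then (f i + min (n - j) 6).choose δ else 0) =
      (if lo + δ ≤ f i + 6 ∧ f i + 6 ≤ hi + δ then (f i + 6).choose δ else 0) + n * (if lo + δ ≤ f i + 6 ∧ f i + 6 ≤ hi + δ then (f i + 6).choose δ else 0) + n.choose 2 * (if lo + δ ≤ f i + 6 ∧ f i + 6 ≤ hi + δ then (f i + 6).choose δ else 0) + n.choose 3 * (if lo + δ ≤ f i + 6 ∧ f i + 6 ≤ hi + δ then (f i + 6).choose δ else 0) + n.choose 4 * (if lo + δ ≤ f i + 6 ∧ f i + 6 ≤ hi + δ then (f i + 6).choose δ else 0) + n.choose 5 * (if lo + δ ≤ f i + 6 ∧ f i + 6 ≤ hi + δ then (f i + 6).choose δ else 0) + (∑ i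 ∈ Ico 6 (n - 5), n.choose i) * (if lo + δ ≤ f i + 6 ∧ f i + 6 ≤ hi + δ then (f i + 6).choose δ else 0) + n.choose 5 * (if lo + δ ≤ f i + 5 ∧ f i + 5 ≤ hi + δ then (f i + 5).choose δ else 0) + n.choose 4 * (if lo + δ ≤ f i + 4 ∧ f i + 4 ≤ hi + δ then (f i + 4).choose δ else 0) + n.choose 3 * (if lo + δ ≤ f i + 3 ∧ f i + 3 ≤ hi + δ then (f i + 3).choose δ else 0) + n.choose 2 * (if lo + δ ≤ f i + 2 ∧ f i + 2 ≤ hi + δ then (f i + 2).choose δ else 0) + n * (if lo + δ ≤ f i + 1 ∧ f i + 1 ≤ hi + δ then (f i + 1).choose δ else 0) + (if lo + δ ≤ f i ∧ f i ≤ hi + δ then (f i).choose δ else 0) :=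
    fun n hn i _ => PLDSixLift.sum_choose_min_six n (by omega)
      (fun _ b => if lo + δ ≤ f i + b ∧ f i + b ≤ hi + δ then (f i + b).choose δ else 0)
  rw [sum_congr rfl (hLm m hm), sum_congr rfl (hRm m hm)]
  rw [sum_congr rfl (hLm 12 le_rfl), sum_congr rfl (hRm 12 le_rfl)] at h₀
  simp only [sum_add_distrib, ← mul_sum] at h₀ hq hq' hq'' hq''' ⊢
  rw [sum_add_distrib, sum_add_distrib] at hT
  -- the coefficients
  obtain ⟨k, hk⟩ := Nat.exists_eq_add_of_le hm
  obtain ⟨k', hk'⟩ := Nat.exists_eq_add_of_le (PLDSixLift.sum_choose_mid6_mono 12 m hm)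
  have hC2 : 120 * m.choose 2 = 7920 + 1380 * k + 60 * k * k := by rw [hk]; exact choose_two_twelve_nine k
  have hC3 : 120 * m.choose 3 = 26400 + 7240 * k + 660 * k * k + 20 * k * k * k := by rw [hk]; exact choose_three_twelve_nine k
  have hC4 : 120 * m.choose 4 = 59400 + 22890 * k + 3295 * k * k + 210 * k * k * k + 5 * k * k * k * k := by rw [hk]; exact choose_four_twelve_nine k
  have hC5 : 120 * m.choose 5 = 95040 + 48504 * k + 9850 * k * k + 995 * k * k * k + 50 * k * k * k * k + k * k * k * k * k := by rw [hk]; exact choose_five_twelve_nine k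
  have hm0c2 : Nat.choose 12 2 = 66 := by decide
  have hm0c3 : Nat.choose 12 3 = 220 := by decide
  have hm0c4 : Nat.choose 12 4 = 495 := by decide
  have hm0c5 : Nat.choose 12 5 = 792 := by decide
  rw [hm0c2, hm0c3, hm0c4, hm0c5] at h₀
  rw [hk']
  rw [hk] at hC2 hC3 hC4 hC5 ⊢
  exact lift_alg_six_nine _ _ _ _ _ _ _ _ _ _ _ _ _ _ _ _ _ _ _ _ _ _ _ _ _ _ _ _ _ _ _ _ _ hC2 hC3 hC4 hC5 h₀ hq hq' hq'' hq''' hT hS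

end PLDSixLift

end PercRepro
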